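import Literature.Probability.Percolation.TwoClusterGibbsCovariance
import HarnessLib

/-!
# Covariances along the two-cluster Gibbs sampler of van den Berg–Häggström–Kahn (2006), §2.1 — JOINT tests:
# the one-step decomposition with its cross term, and the reduction theorem for a test `h(C_S, C_T)` that is
# decreasing in the conditioning cluster

Topic `Literature/Probability/Percolation`; companion of `TwoClusterGibbsCovariance.lean` (test functions of `C_S`
only) and `TwoClusterGibbsSampler.lean` (BHK's chain `(C_S, C_T) ↦ (C_S', C_T')` at `q = 1`).  ALL declarations are
definitions with bodies or theorems (D-0014/D-0026: no named fact is introduced).  This file is the finite-sum layer;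
the measure-level forms (`prodBernoulli`, one source vertex, the hub test of a vertex set) are in
`TwoClusterGibbsJointCovarianceMeasure.lean` and `TwoClusterGibbsHubCovariance.lean`.

Written for the MIXED conditioned slack hierarchy of the `prim` cell's proof of Kozma–Nitzan's Question 9
(arXiv:2401.12397 §5.5; seat memos run/shared/lean/prim/prim-ineq-gen-7/PROOF-Q9-MIXED-CSH.md §3.1 and
Q9-WRITEUP.md Lemma 6.1, "Lemma T, mixed"): there ONE observation indicator `1{o ∈ C_S}` of the hierarchy is replaced by
the hub test `1{Σ ∩ C_S ≠ ∅}·1{Σ ↮ T}` of a vertex set `Σ`, which depends on BOTH clusters — increasing in `C_S`,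
DECREASING in the cluster of the avoided set `T`.

## The mathematics

Bond percolation with pair probabilities `w` on a finite vertex type, vertex sets `S, T`, `D = {S ↮ T}`, `(A φ)(B) =
E[φ(C_S) | C_T = B]` (BHK Lemma 2.4: a fresh configuration off `T ∪ V(B)`), `𝑇` BHK's one-step operator on functions of
`C_S` (`BHK2006.gibbsT`).  For a function `φ` of `C_S` and a JOINT test `h(C_S, C_T)` put
`cov_D(φ, h) = P(D)·E[φ h 1_D] − E[φ 1_D]·E[h 1_D]` (`covDST`) and
`R(φ) = E[ Cov(φ(C_S), h(C_S, C_T) | C_T) ; D ]` (`withinDST`, the test frozen at the conditioning cluster).  The law of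
total covariance along `σ(C_T)` and the two half-steps of the chain give the exact ONE-STEP DECOMPOSITION

  `cov_D(φ, h) = P(D)·( R(φ) + X(φ) ) + cov_D(𝑇φ, h)`        (`BHK2006.covDST_eq_withinDST_add`),

where the CROSS TERM `X(φ) = E[ 1_D · Cov_η( (Aφ)(C_T'), h(C_S, C_T') ) ]` (`crossDST`; `C_T' = ` the cluster of `T` in a
fresh configuration `η` off `S ∪ V(C_S)`, i.e. the `T`-half-step) records that the test moves with the resampled
conditioning cluster; it vanishes for a test of `C_S` alone (`crossDST_const`), recovering `covD_eq_withinD_add`.  Since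
`(Aφ)(B)` is DECREASING in `B` for increasing `φ` (Remark 2.8) and `C_T'` is increasing in `η`, Harris' inequality gives
`X(φ) ≥ 0` whenever `h(C, ·)` is decreasing for every `C` (`crossDST_nonneg`).  Hence the REDUCTION THEOREM
(`BHK2006.covDST_nonneg_of_withinDST_nonneg`): if every non-loop pair meeting `T` has `w e < 1`, `h(C, ·)` is decreasing
for every `C`, and `R(g) ≥ 0` for every monotone nonnegative `g`, then `cov_D(f, h) ≥ 0` for every monotone `f` — by the
telescoped decomposition (`covDST_eq_sum_withinDST_add`), monotonicity/positivity of the iterates `𝑇ᵏ(f − f ∅)` and the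
regeneration contraction of the companion files.

Not in print in this form; it is BHK's proof scheme of Thm. 2.1 (pp. 10–11: "`φ̂` is stationary for this chain … so to
prove Theorem 2.1 it's enough to show Claim 2.5") run for a test of both clusters, with Harris' inequality for the extra
half-step, derived here.  Not here: tests increasing in `C_T` (the cross term then has the wrong sign), `q > 1`
(random-cluster weights), more than two clusters.
[cite: VandenbergHaggstromKahn2005, §2.1 pp. 9–13 (Lemmas 2.3–2.4, the chain, Claim 2.5, Remark 2.8); §1 p. 4 display (4) (Harris)]
-/

noncomputable section

open MeasureTheory unitInterval
open Literature.Probability.LatticeModels (prodBernoulli)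

namespace Literature.Probability.Percolation

namespace BHK2006

open scoped Classical
open DecisionTree (ind ind_of_mem ind_of_not_mem ind_nonneg)

section Sums

variable {V : Type*} [Fintype V]

/-! ### Joint tests `h(C_S, C_T)`: the conditional and the averaged one-step covariances -/

/-- **Conditional covariance given `C_T = B`** of `φ(C_S)` and a JOINT test `h(C_S, C_T)`:
`E[φ(C_S) h(C_S, B) | C_T = B] − E[φ(C_S) | C_T = B]·E[h(C_S, B) | C_T = B]` (the test is frozen at the
conditioning cluster `B`). [cite: VandenbergHaggstromKahn2005, §2.1 Lemma 2.4 (p. 10)] -/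
def condCovST (w : Sym2 V → ℝ) (S T : Set V) (φ : Set (Sym2 V) → ℝ)
    (h : Set (Sym2 V) → Set (Sym2 V) → ℝ) (B : Set (Sym2 V)) : ℝ :=
  condS w S T (fun A => φ A * h A B) B - condS w S T φ B * condS w S T (fun A => h A B) B

/-- **The averaged one-step ("within") covariance for a joint test**:
`R(φ) = E[ Cov(φ(C_S), h(C_S, C_T) | C_T) 1_D ]` (denominator-free).
[cite: VandenbergHaggstromKahn2005, §2.1 pp. 10–11] -/
def withinDST (w : Sym2 V → ℝ) (S T : Set V) (D : Set (Set (Sym2 V))) (φ : Set (Sym2 V) → ℝ)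
    (h : Set (Sym2 V) → Set (Sym2 V) → ℝ) : ℝ :=
  ∑ ω, weight w ω * (condCovST w S T φ h (setCl ω T) * ind D ω)

/-- **Denominator-free conditional covariance on `D`** of `φ(C_S)` and a joint test `h(C_S, C_T)`:
`cov_D(φ, h) = P(D)·E[φ(C_S) h(C_S, C_T) 1_D] − E[φ(C_S) 1_D]·E[h(C_S, C_T) 1_D]`.
[cite: VandenbergHaggstromKahn2005, Thm. 1.5 eq. (9) (p. 7)] -/
def covDST (w : Sym2 V → ℝ) (S T : Set V) (D : Set (Set (Sym2 V))) (φ : Set (Sym2 V) → ℝ)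
    (h : Set (Sym2 V) → Set (Sym2 V) → ℝ) : ℝ :=
  (∑ ω, weight w ω * ind D ω) *
      (∑ ω, weight w ω * (φ (setCl ω S) * h (setCl ω S) (setCl ω T) * ind D ω)) -
    (∑ ω, weight w ω * (φ (setCl ω S) * ind D ω)) *
      (∑ ω, weight w ω * (h (setCl ω S) (setCl ω T) * ind D ω))

/-- **The cross term of the `T`-half-step for a joint test**:
`X(φ) = E[ 1_D · Cov_η( (Aφ)(C_T'), h(C_S, C_T') ) ]`, where given `C_S` the new `C_T' = halfT C_S η` is
the cluster of `T` in a fresh configuration `η` and `(Aφ)(B) = E[φ(C_S) | C_T = B]` — the covariance,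
over the fresh configuration, of the (decreasing) conditional mean of `φ` with the test read at the new
conditioning cluster.  It vanishes when `h` does not depend on `C_T`.
[cite: VandenbergHaggstromKahn2005, §2.1 pp. 10–12 (the chain; Remark 2.8: "`C_T^n` is decreasing")] -/
def crossDST (w : Sym2 V → ℝ) (S T : Set V) (D : Set (Set (Sym2 V))) (φ : Set (Sym2 V) → ℝ)
    (h : Set (Sym2 V) → Set (Sym2 V) → ℝ) : ℝ :=
  ∑ ω, weight w ω *
    (((∑ η, weight w η *
          (condS w S T φ (halfT S T (setCl ω S) η) * h (setCl ω S) (halfT S T (setCl ω S) η))) -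
        gibbsT w S T φ (setCl ω S) *
          (∑ η, weight w η * h (setCl ω S) (halfT S T (setCl ω S) η))) * ind D ω)

/-- For a test not depending on `C_T` the joint quantities are the one-cluster ones:
`condCovST (h ∘ fst) = condCov h`. [cite: VandenbergHaggstromKahn2005, §2.1 Lemma 2.4 (p. 10) — bookkeeping, derived here] -/
theorem condCovST_const (w : Sym2 V → ℝ) (S T : Set V) (φ h : Set (Sym2 V) → ℝ) (B : Set (Sym2 V)) :
    condCovST w S T φ (fun A _ => h A) B = condCov w S T φ h B := rfl

/-- `covDST (h ∘ fst) = covD h`. [cite: VandenbergHaggstromKahn2005, Thm. 1.5 eq. (9) (p. 7) — bookkeeping, derived here] -/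
theorem covDST_const (w : Sym2 V → ℝ) (S T : Set V) (D : Set (Set (Sym2 V))) (φ h : Set (Sym2 V) → ℝ) :
    covDST w S T D φ (fun A _ => h A) = covD w S D φ h := rfl

/-- `X(φ) = 0` for a test not depending on `C_T` (then the one-step decomposition is `covD_eq_withinD_add`).
[cite: VandenbergHaggstromKahn2005, §2.1 pp. 10–11 (the chain) — corollary, derived here] -/
theorem crossDST_const (w : Sym2 V → ℝ) (hm : ∑ ω, weight w ω = 1) (S T : Set V)
    (D : Set (Set (Sym2 V))) (φ h : Set (Sym2 V) → ℝ) :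
    crossDST w S T D φ (fun A _ => h A) = 0 := by
  refine Finset.sum_eq_zero fun ω _ => ?_
  have e1 : ∑ η, weight w η * (condS w S T φ (halfT S T (setCl ω S) η) * h (setCl ω S)) =
      gibbsT w S T φ (setCl ω S) * h (setCl ω S) := by
    rw [gibbsT, Finset.sum_mul]
    exact Finset.sum_congr rfl fun η _ => by ring
  have e2 : ∑ η, weight w η * h (setCl ω S) = h (setCl ω S) := by
    rw [← Finset.sum_mul, hm, one_mul]
  rw [e1, e2, sub_self, zero_mul, mul_zero]

/-! ### The one-step decomposition with the cross term -/

/-- **One-step covariance decomposition along BHK's chain, joint test**: for any function `φ` of `C_S`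
and any joint test `h` of `(C_S, C_T)`,
`cov_D(φ, h) = P(D)·(R(φ) + X(φ)) + cov_D(𝑇φ, h)` — an exact identity (law of total covariance along
`z(C_T)`, then the `T`-half-step, which for a test depending on `C_T` leaves the cross covariance `X(φ)`).
[cite: VandenbergHaggstromKahn2005, §2.1 Lemma 2.4 (p. 10) and pp. 10–11 (the chain) — corollary, derived here] -/
theorem covDST_eq_withinDST_add (w : Sym2 V → ℝ) (hm : ∑ ω, weight w ω = 1) (S T : Set V)
    {D : Set (Set (Sym2 V))} (hD : ∀ ω, ω ∈ D ↔ ∀ s ∈ S, ∀ t ∈ T, ¬ (openGraph ω).Reachable s t)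
    (φ : Set (Sym2 V) → ℝ) (h : Set (Sym2 V) → Set (Sym2 V) → ℝ) :
    covDST w S T D φ h =
      (∑ ω, weight w ω * ind D ω) * (withinDST w S T D φ h + crossDST w S T D φ h) +
        covDST w S T D (gibbsT w S T φ) h := by
  -- (e1)–(e3): `E[ψ(C_S, C_T) 1_D] = E[(A ψ(·, C_T))(C_T) 1_D]` for `ψ = φh, φ, h` (the `S`-half-step)
  have e1 : ∑ ω, weight w ω * (φ (setCl ω S) * h (setCl ω S) (setCl ω T) * ind D ω) =
      ∑ ω, weight w ω * (condS w S T (fun A => φ A * h A (setCl ω T)) (setCl ω T) * ind D ω) :=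
    set_sum_cond_cluster' w hm S T (fun A B => φ A * h A B) hD
  have e2 : ∑ ω, weight w ω * (φ (setCl ω S) * ind D ω) =
      ∑ ω, weight w ω * (condS w S T φ (setCl ω T) * ind D ω) :=
    set_sum_cond_cluster' w hm S T (fun A _ => φ A) hD
  have e3 : ∑ ω, weight w ω * (h (setCl ω S) (setCl ω T) * ind D ω) =
      ∑ ω, weight w ω * (condS w S T (fun A => h A (setCl ω T)) (setCl ω T) * ind D ω) :=
    set_sum_cond_cluster' w hm S T (fun A B => h A B) hD
  -- (e5): `E[(Aφ)(C_T) (A h(·,C_T))(C_T) 1_D] = E[(Aφ)(C_T) h(C_S, C_T) 1_D]` (the `S`-half-step backwards)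
  have e5 : ∑ ω, weight w ω * (condS w S T φ (setCl ω T) * h (setCl ω S) (setCl ω T) * ind D ω) =
      ∑ ω, weight w ω * (condS w S T φ (setCl ω T) *
        condS w S T (fun A => h A (setCl ω T)) (setCl ω T) * ind D ω) := by
    rw [set_sum_cond_cluster' w hm S T (fun A B => condS w S T φ B * h A B) hD]
    refine Finset.sum_congr rfl fun ω _ => ?_
    congr 1
    congr 1
    have hc : condS w S T (fun A => h A (setCl ω T)) (setCl ω T) =
        ∑ η, weight w η * h (halfS S T (setCl ω T) η) (setCl ω T) := rfl
    rw [hc, Finset.mul_sum]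
    refine Finset.sum_congr rfl fun η _ => ?_
    simp only [halfS]
    ring
  -- (e4): `E[(Aφ)(C_T) h(C_S, C_T) 1_D] = E[1_D Σ_η w(η) (Aφ)(C_T'(η)) h(C_S, C_T'(η))]` (the `T`-half-step)
  have e4 : ∑ ω, weight w ω * (condS w S T φ (setCl ω T) * h (setCl ω S) (setCl ω T) * ind D ω) =
      ∑ ω, weight w ω * ((∑ η, weight w η *
        (condS w S T φ (halfT S T (setCl ω S) η) * h (setCl ω S) (halfT S T (setCl ω S) η))) *
          ind D ω) :=
    set_sum_cond_cluster w hm S T (fun A B => condS w S T φ B * h A B) hD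
  -- (e7): `E[(𝑇φ)(C_S) h(C_S, C_T) 1_D] = E[1_D (𝑇φ)(C_S) Σ_η w(η) h(C_S, C_T'(η))]`
  have e7 : ∑ ω, weight w ω * (gibbsT w S T φ (setCl ω S) * h (setCl ω S) (setCl ω T) * ind D ω) =
      ∑ ω, weight w ω * (gibbsT w S T φ (setCl ω S) *
        (∑ η, weight w η * h (setCl ω S) (halfT S T (setCl ω S) η)) * ind D ω) := by
    rw [set_sum_cond_cluster w hm S T (fun A B => gibbsT w S T φ A * h A B) hD]
    refine Finset.sum_congr rfl fun ω _ => ?_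
    congr 1
    congr 1
    rw [Finset.mul_sum]
    exact Finset.sum_congr rfl fun η _ => by simp only [halfT]; ring
  -- (e6): `E[(𝑇φ)(C_S) 1_D] = E[(Aφ)(C_T) 1_D]`
  have e6 : ∑ ω, weight w ω * (gibbsT w S T φ (setCl ω S) * ind D ω) =
      ∑ ω, weight w ω * (condS w S T φ (setCl ω T) * ind D ω) :=
    (set_sum_cond_cluster w hm S T (fun _ B => condS w S T φ B) hD).symm
  -- the within part as a difference
  have hW : withinDST w S T D φ h =
      (∑ ω, weight w ω * (condS w S T (fun A => φ A * h A (setCl ω T)) (setCl ω T) * ind D ω)) -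
        ∑ ω, weight w ω * (condS w S T φ (setCl ω T) *
          condS w S T (fun A => h A (setCl ω T)) (setCl ω T) * ind D ω) := by
    rw [withinDST, ← Finset.sum_sub_distrib]
    exact Finset.sum_congr rfl fun ω _ => by rw [condCovST]; ring
  -- the cross part as a difference
  have hX : crossDST w S T D φ h =
      (∑ ω, weight w ω * ((∑ η, weight w η *
        (condS w S T φ (halfT S T (setCl ω S) η) * h (setCl ω S) (halfT S T (setCl ω S) η))) *
          ind D ω)) -
        ∑ ω, weight w ω * (gibbsT w S T φ (setCl ω S) *
          (∑ η, weight w η * h (setCl ω S) (halfT S T (setCl ω S) η)) * ind D ω) := by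
    rw [crossDST, ← Finset.sum_sub_distrib]
    exact Finset.sum_congr rfl fun ω _ => by ring
  rw [covDST, covDST, e1, e2, e3, hW, hX, ← e4, e5, ← e7, e6]
  ring

/-- **The cross term is nonnegative** for monotone `φ` and a joint test DECREASING in the conditioning
cluster: given `C_S`, the new `C_T'` is increasing in the fresh configuration, `(Aφ)(C_T')` and
`h(C_S, C_T')` are both decreasing in it, and Harris' inequality applies.
[cite: VandenbergHaggstromKahn2005, §2.1 Remark 2.8 (p. 12); §1 p. 4, display (4) (Harris)] -/
theorem crossDST_nonneg {w : Sym2 V → ℝ} (hw0 : ∀ e, 0 ≤ w e) (hw1 : ∀ e, w e ≤ 1)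
    (hm : ∑ ω, weight w ω = 1) (S T : Set V) (D : Set (Set (Sym2 V))) {φ : Set (Sym2 V) → ℝ}
    (hφ : Monotone φ) {h : Set (Sym2 V) → Set (Sym2 V) → ℝ} (hh : ∀ A, Antitone (h A)) :
    0 ≤ crossDST w S T D φ h := by
  refine Finset.sum_nonneg fun ω _ => mul_nonneg (weight_nonneg hw0 hw1 ω)
    (mul_nonneg (sub_nonneg.2 ?_) (ind_nonneg D ω))
  set A : Set (Sym2 V) := setCl ω S with hA
  set f : Set (Sym2 V) → ℝ := fun η => condS w S T φ (halfT S T A η) with hf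
  set g : Set (Sym2 V) → ℝ := fun η => h A (halfT S T A η) with hg
  have hfa : Antitone f := fun η η' hηη' =>
    condS_antitone hw0 hw1 S T hφ (halfT_mono S T le_rfl hηη')
  have hga : Antitone g := fun η η' hηη' => hh A (halfT_mono S T le_rfl hηη')
  have hfM : ∀ η, f η ≤ ∑ η', |f η'| := fun η =>
    (le_abs_self _).trans (Finset.single_le_sum (f := fun η' => |f η'|) (fun _ _ => abs_nonneg _)
      (Finset.mem_univ η))
  have hgN : ∀ η, g η ≤ ∑ η', |g η'| := fun η =>
    (le_abs_self _).trans (Finset.single_le_sum (f := fun η' => |g η'|) (fun _ _ => abs_nonneg _)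
      (Finset.mem_univ η))
  have key := harris_anti_anti hw0 hw1 hm hfa hga hfM hgN
  have hT : gibbsT w S T φ A = ∑ η, weight w η * f η := rfl
  rw [hT]
  exact key

/-- **Telescoped form, joint test**: `cov_D(φ, h) = P(D) Σ_{k<n} (R(𝑇ᵏφ) + X(𝑇ᵏφ)) + cov_D(𝑇ⁿφ, h)`.
[cite: VandenbergHaggstromKahn2005, §2.1 pp. 10–11 — corollary, derived here] -/
theorem covDST_eq_sum_withinDST_add (w : Sym2 V → ℝ) (hm : ∑ ω, weight w ω = 1) (S T : Set V)
    {D : Set (Set (Sym2 V))} (hD : ∀ ω, ω ∈ D ↔ ∀ s ∈ S, ∀ t ∈ T, ¬ (openGraph ω).Reachable s t)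
    (φ : Set (Sym2 V) → ℝ) (h : Set (Sym2 V) → Set (Sym2 V) → ℝ) (n : ℕ) :
    covDST w S T D φ h = (∑ ω, weight w ω * ind D ω) *
        ∑ k ∈ Finset.range n, (withinDST w S T D ((gibbsT w S T)^[k] φ) h +
          crossDST w S T D ((gibbsT w S T)^[k] φ) h) +
      covDST w S T D ((gibbsT w S T)^[n] φ) h := by
  induction n with
  | zero => simp
  | succ n ih =>
    rw [Finset.sum_range_succ, mul_add, Function.iterate_succ_apply', ih,
      covDST_eq_withinDST_add w hm S T hD ((gibbsT w S T)^[n] φ) h]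
    ring

/-- `cov_D(φ − c, h) = cov_D(φ, h)` (joint test). [folklore] -/
private theorem covDST_sub_const (w : Sym2 V → ℝ) (S T : Set V) (D : Set (Set (Sym2 V)))
    (φ : Set (Sym2 V) → ℝ) (h : Set (Sym2 V) → Set (Sym2 V) → ℝ) (c : ℝ) :
    covDST w S T D (fun A => φ A - c) h = covDST w S T D φ h := by
  have h1 : ∀ ω : Set (Sym2 V),
      weight w ω * ((φ (setCl ω S) - c) * h (setCl ω S) (setCl ω T) * ind D ω) =
      weight w ω * (φ (setCl ω S) * h (setCl ω S) (setCl ω T) * ind D ω) -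
        c * (weight w ω * (h (setCl ω S) (setCl ω T) * ind D ω)) := fun ω => by ring
  have h2 : ∀ ω : Set (Sym2 V), weight w ω * ((φ (setCl ω S) - c) * ind D ω) =
      weight w ω * (φ (setCl ω S) * ind D ω) - c * (weight w ω * ind D ω) := fun ω => by ring
  simp only [covDST, h1, h2, Finset.sum_sub_distrib, ← Finset.mul_sum]
  ring

/-- `|E[g 1_D]| ≤ c · P(D)` when `|g| ≤ c`. [folklore] -/
private theorem abs_sum_ind_le' {w : Sym2 V → ℝ} (hw0 : ∀ e, 0 ≤ w e) (hw1 : ∀ e, w e ≤ 1)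
    (D : Set (Set (Sym2 V))) {g : Set (Sym2 V) → ℝ} {c : ℝ} (hg : ∀ ω, |g ω| ≤ c) :
    |∑ ω, weight w ω * (g ω * ind D ω)| ≤ c * ∑ ω, weight w ω * ind D ω := by
  calc |∑ ω, weight w ω * (g ω * ind D ω)| ≤ ∑ ω, |weight w ω * (g ω * ind D ω)| :=
        Finset.abs_sum_le_sum_abs _ _
    _ ≤ ∑ ω, c * (weight w ω * ind D ω) := Finset.sum_le_sum fun ω _ => by
        rw [abs_mul, abs_mul, abs_of_nonneg (weight_nonneg hw0 hw1 ω), abs_of_nonneg (ind_nonneg D ω)]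
        calc weight w ω * (|g ω| * ind D ω) ≤ weight w ω * (c * ind D ω) :=
              mul_le_mul_of_nonneg_left (mul_le_mul_of_nonneg_right (hg ω) (ind_nonneg D ω))
                (weight_nonneg hw0 hw1 ω)
          _ = c * (weight w ω * ind D ω) := by ring
    _ = c * ∑ ω, weight w ω * ind D ω := by rw [Finset.mul_sum]

/-- **Small oscillation ⟹ small covariance** (joint test): if `φ A − φ A' ≤ δ` for all `A, A'` and
`|h| ≤ M`, then `|cov_D(φ, h)| ≤ 2 δ M`. [folklore] -/
private theorem abs_covDST_le {w : Sym2 V → ℝ} (hw0 : ∀ e, 0 ≤ w e) (hw1 : ∀ e, w e ≤ 1)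
    (hm : ∑ ω, weight w ω = 1) (S T : Set V) (D : Set (Set (Sym2 V))) {φ : Set (Sym2 V) → ℝ}
    {h : Set (Sym2 V) → Set (Sym2 V) → ℝ} {δ M : ℝ} (hφ : ∀ A A', φ A - φ A' ≤ δ)
    (hM : ∀ A B, |h A B| ≤ M) :
    |covDST w S T D φ h| ≤ 2 * δ * M := by
  have hδ : 0 ≤ δ := by simpa using hφ ∅ ∅
  have hM0 : 0 ≤ M := (abs_nonneg _).trans (hM ∅ ∅)
  set mD : ℝ := ∑ ω, weight w ω * ind D ω with hmD
  have hmD0 : 0 ≤ mD := Finset.sum_nonneg fun ω _ => mul_nonneg (weight_nonneg hw0 hw1 ω) (ind_nonneg D ω)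
  have hmD1 : mD ≤ 1 := by
    calc mD ≤ ∑ ω, weight w ω := Finset.sum_le_sum fun ω _ => by
            simpa using mul_le_mul_of_nonneg_left (ind_le_one D ω) (weight_nonneg hw0 hw1 ω)
      _ = 1 := hm
  rw [← covDST_sub_const w S T D φ h (φ ∅)]
  set ψ : Set (Sym2 V) → ℝ := fun A => φ A - φ ∅ with hψ
  have hψb : ∀ A, |ψ A| ≤ δ := fun A => abs_sub_le_iff.2 ⟨hφ A ∅, by linarith [hφ ∅ A]⟩
  have b1 : |∑ ω, weight w ω * (ψ (setCl ω S) * h (setCl ω S) (setCl ω T) * ind D ω)| ≤ δ * M * mD := by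
    have := abs_sum_ind_le' hw0 hw1 D (g := fun ω => ψ (setCl ω S) * h (setCl ω S) (setCl ω T))
      (c := δ * M) (fun ω => by rw [abs_mul]; exact mul_le_mul (hψb _) (hM _ _) (abs_nonneg _) hδ)
    simpa only [hmD] using this
  have b2 : |∑ ω, weight w ω * (ψ (setCl ω S) * ind D ω)| ≤ δ * mD :=
    abs_sum_ind_le' hw0 hw1 D (g := fun ω => ψ (setCl ω S)) (fun ω => hψb _)
  have b3 : |∑ ω, weight w ω * (h (setCl ω S) (setCl ω T) * ind D ω)| ≤ M * mD :=
    abs_sum_ind_le' hw0 hw1 D (g := fun ω => h (setCl ω S) (setCl ω T)) (fun ω => hM _ _)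
  have hcov : covDST w S T D ψ h =
      mD * (∑ ω, weight w ω * (ψ (setCl ω S) * h (setCl ω S) (setCl ω T) * ind D ω)) -
        (∑ ω, weight w ω * (ψ (setCl ω S) * ind D ω)) *
          (∑ ω, weight w ω * (h (setCl ω S) (setCl ω T) * ind D ω)) := rfl
  rw [hcov]
  have t1 : |mD * ∑ ω, weight w ω * (ψ (setCl ω S) * h (setCl ω S) (setCl ω T) * ind D ω)| ≤ δ * M := by
    rw [abs_mul, abs_of_nonneg hmD0]
    calc mD * |∑ ω, weight w ω * (ψ (setCl ω S) * h (setCl ω S) (setCl ω T) * ind D ω)|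
        ≤ 1 * (δ * M * mD) := mul_le_mul hmD1 b1 (abs_nonneg _) zero_le_one
      _ ≤ δ * M := by rw [one_mul]; exact mul_le_of_le_one_right (mul_nonneg hδ hM0) hmD1
  have t2 : |(∑ ω, weight w ω * (ψ (setCl ω S) * ind D ω)) *
      (∑ ω, weight w ω * (h (setCl ω S) (setCl ω T) * ind D ω))| ≤ δ * M := by
    rw [abs_mul]
    calc |∑ ω, weight w ω * (ψ (setCl ω S) * ind D ω)| *
          |∑ ω, weight w ω * (h (setCl ω S) (setCl ω T) * ind D ω)|
        ≤ (δ * mD) * (M * mD) := mul_le_mul b2 b3 (abs_nonneg _) (by positivity)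
      _ ≤ δ * M := by nlinarith [mul_nonneg hδ hM0, mul_le_one₀ hmD1 hmD0 hmD1]
  calc |mD * (∑ ω, weight w ω * (ψ (setCl ω S) * h (setCl ω S) (setCl ω T) * ind D ω)) -
        (∑ ω, weight w ω * (ψ (setCl ω S) * ind D ω)) *
          (∑ ω, weight w ω * (h (setCl ω S) (setCl ω T) * ind D ω))|
      ≤ |mD * ∑ ω, weight w ω * (ψ (setCl ω S) * h (setCl ω S) (setCl ω T) * ind D ω)| +
          |(∑ ω, weight w ω * (ψ (setCl ω S) * ind D ω)) *
            (∑ ω, weight w ω * (h (setCl ω S) (setCl ω T) * ind D ω))| := abs_sub _ _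
    _ ≤ 2 * δ * M := by linarith

/-- `regenWeight w T ≤ 1`. [folklore] -/
private theorem regenWeight_le_one'' {w : Sym2 V → ℝ} (hw0 : ∀ e, 0 ≤ w e) (hw1 : ∀ e, w e ≤ 1)
    (hm : ∑ ω, weight w ω = 1) (T : Set V) : regenWeight w T ≤ 1 := by
  calc regenWeight w T ≤ ∑ η, weight w η := Finset.sum_le_sum fun η _ => by
          simpa using mul_le_mul_of_nonneg_left (ind_le_one (regenT T) η) (weight_nonneg hw0 hw1 η)
    _ = 1 := hm

/-! ### The reduction theorem for a joint test -/

/-- **Reduction of a conditional covariance sign to the averaged one-step covariances, for a test of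
BOTH clusters.**  Bond percolation with pair probabilities `w ∈ [0,1]` on a finite vertex type such that
every non-loop pair meeting `T` has `w e < 1`; `D = {S ↮ T}`; `h(C_S, C_T)` ANY joint test that is
DECREASING in the second (conditioning) cluster.  If `R(g) = E[Cov(g(C_S), h(C_S, C_T) | C_T); D] ≥ 0` for
every monotone nonnegative `g`, then `cov_D(f, h) = P(D)E[f h 1_D] − E[f 1_D]E[h 1_D] ≥ 0` for every
monotone `f`.  Proof: the telescoped decomposition; the within terms are `≥ 0` by hypothesis, the cross
terms by Harris (`crossDST_nonneg`), and the tail is `O((1−ε)ⁿ)`.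
[cite: VandenbergHaggstromKahn2005, §2.1 pp. 10–13 (the chain, Claim 2.5, Remark 2.8) — corollary, derived here] -/
theorem covDST_nonneg_of_withinDST_nonneg {w : Sym2 V → ℝ} (hw0 : ∀ e, 0 ≤ w e) (hw1 : ∀ e, w e ≤ 1)
    (hm : ∑ ω, weight w ω = 1) (S T : Set V) {D : Set (Set (Sym2 V))}
    (hD : ∀ ω, ω ∈ D ↔ ∀ s ∈ S, ∀ t ∈ T, ¬ (openGraph ω).Reachable s t)
    (hε : 0 < regenWeight w T) {h : Set (Sym2 V) → Set (Sym2 V) → ℝ} (hh : ∀ A, Antitone (h A))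
    (hR : ∀ g : Set (Sym2 V) → ℝ, Monotone g → (∀ A, 0 ≤ g A) → 0 ≤ withinDST w S T D g h)
    {f : Set (Sym2 V) → ℝ} (hf : Monotone f) : 0 ≤ covDST w S T D f h := by
  set f₀ : Set (Sym2 V) → ℝ := fun A => f A - f ∅ with hf₀
  have hf₀m : Monotone f₀ := fun A A' hAA' => sub_le_sub_right (hf hAA') _
  have hf₀0 : ∀ A, 0 ≤ f₀ A := fun A => sub_nonneg.2 (hf (Set.empty_subset A))
  set c : ℝ := f Set.univ - f ∅ with hc
  have hosc : ∀ A A', f₀ A - f₀ A' ≤ c := fun A A' => by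
    simp only [hf₀, hc]
    linarith [hf (Set.subset_univ A), hf (Set.empty_subset A')]
  set M : ℝ := ∑ A : Set (Sym2 V), ∑ B : Set (Sym2 V), |h A B| with hMdef
  have hM : ∀ A B, |h A B| ≤ M := fun A B =>
    (Finset.single_le_sum (f := fun B' => |h A B'|) (fun _ _ => abs_nonneg _) (Finset.mem_univ B)).trans
      (Finset.single_le_sum (f := fun A' => ∑ B' : Set (Sym2 V), |h A' B'|)
        (fun _ _ => Finset.sum_nonneg fun _ _ => abs_nonneg _) (Finset.mem_univ A))
  set mD : ℝ := ∑ ω, weight w ω * ind D ω with hmD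
  have hmD0 : 0 ≤ mD := Finset.sum_nonneg fun ω _ => mul_nonneg (weight_nonneg hw0 hw1 ω) (ind_nonneg D ω)
  set ρ : ℝ := 1 - regenWeight w T with hρ
  have hρ0 : 0 ≤ ρ := sub_nonneg.2 (regenWeight_le_one'' hw0 hw1 hm T)
  have hρ1 : ρ < 1 := by simp only [hρ]; linarith
  -- the lower bound for every `n`
  have key : ∀ n : ℕ, -(2 * (ρ ^ n * c) * M) ≤ covDST w S T D f₀ h := by
    intro n
    rw [covDST_eq_sum_withinDST_add w hm S T hD f₀ h n]
    have h1 : 0 ≤ mD * ∑ k ∈ Finset.range n, (withinDST w S T D ((gibbsT w S T)^[k] f₀) h +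
        crossDST w S T D ((gibbsT w S T)^[k] f₀) h) :=
      mul_nonneg hmD0 (Finset.sum_nonneg fun k _ => add_nonneg
        (hR _ (gibbsT_iterate_mono_nonneg hw0 hw1 S T hf₀m hf₀0 k).1
          (gibbsT_iterate_mono_nonneg hw0 hw1 S T hf₀m hf₀0 k).2)
        (crossDST_nonneg hw0 hw1 hm S T D (gibbsT_iterate_mono_nonneg hw0 hw1 S T hf₀m hf₀0 k).1 hh))
    have h2 : |covDST w S T D ((gibbsT w S T)^[n] f₀) h| ≤ 2 * (ρ ^ n * c) * M :=
      abs_covDST_le hw0 hw1 hm S T D (gibbsT_iterate_sub_le hw0 hw1 hm S T n hosc) hM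
    linarith [neg_abs_le (covDST w S T D ((gibbsT w S T)^[n] f₀) h)]
  -- let `n → ∞`
  have hlim : Filter.Tendsto (fun n : ℕ => -(2 * (ρ ^ n * c) * M)) Filter.atTop (nhds 0) := by
    have h0 : Filter.Tendsto (fun n : ℕ => ρ ^ n) Filter.atTop (nhds 0) :=
      tendsto_pow_atTop_nhds_zero_of_lt_one hρ0 hρ1
    have : Filter.Tendsto (fun n : ℕ => -(2 * (ρ ^ n * c) * M)) Filter.atTop
        (nhds (-(2 * (0 * c) * M))) :=
      (((h0.mul_const c).const_mul 2).mul_const M).neg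
    simpa using this
  have hge : 0 ≤ covDST w S T D f₀ h := le_of_tendsto' hlim key
  rwa [hf₀, covDST_sub_const] at hge

end Sums

end BHK2006

end Literature.Probability.Percolation

end
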